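import Summits.BirchSwinnertonDyer.BirchSwinnertonDyer.Theses.DefiniteTheta
import Summits.BirchSwinnertonDyer.BirchSwinnertonDyer.Theorems.DefiniteThetaDerivedHeightCapBirthTowerSqrt
import Summits.BirchSwinnertonDyer.BirchSwinnertonDyer.Theorems.DefiniteThetaDerivedHeightCapBirthNormCompatible
import Literature.NumberTheory.EllipticCurves.BertoliniDarmon2005.ThetaOrderOfVanishingLowerBound
import Literature.NumberTheory.EllipticCurves.GrossPointsThetaElementFacts
import Literature.NumberTheory.EllipticCurves.ModularDegreeMinimal
import Literature.NumberTheory.EllipticCurves.QuadraticTwist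
import Literature.NumberTheory.EllipticCurves.MordellWeil
import Literature.NumberTheory.EllipticCurves.Tamagawa
import Literature.NumberTheory.EllipticCurves.SelmerCorankHolds
import HarnessLib

/-!
# Crux `DerivedHeightCap` (stmt-BirchSwinnertonDyer-18438, route DefiniteTheta), line «birth»: the last stub `stub_lpCap`
# from Bertolini–Darmon 2005, Corollary 3 — the cap at every admissible datum with `p ∤ deg(X₀(N) → E)`, given `#Ш(E/ℚ)[p^∞] < ∞`

Route-independent `Theorems` file (cell `b2b-bsdres`, seat `b2b-bsdres-x10b`, gen 47; `--supports 18438`).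
HONEST FRAMING: prove what is provable now; no claim beyond stated classes. NO summit statement and NO crux is proved
here; BSD is not proved by any of this. What IS proved, sorry-free, is the DESCENT of the crux's last open stub to ONE
printed statement:

* **Input (named fact, cited, nothing asserted):** Bertolini–Darmon, Ann. of Math. 162 (2005), **Cor. 3** — "If `p` is a
  prime of good ordinary reduction for `E`, then `ord_{s=1} L_p(E, K, s) ≥ 2ρ`", `ρ = max(r⁺, r⁻)` the Mordell–Weil ranks of
  `E(ℚ)` and of the twist `E^K(ℚ)` — typed on the tree's finite-level theta elements as the Literature fact
  `Literature.NumberTheory.EllipticCurves.BertoliniDarmon2005.cor3_thetaSq_mem_augIdeal_pow`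
  (file `Literature/NumberTheory/EllipticCurves/BertoliniDarmon2005/ThetaOrderOfVanishingLowerBound.lean`, p759831)
  (`θ_{n+1}^{ac} (θ_{n+1}^{ac})^* ∈ I^{2ρ}` at every level; BD05 define `G̃_∞ = lim Pic(𝒪_{pⁿ})` idelically, §1.2 (13),
  so no class field theory is needed to STATE it), under the paper's hypotheses: Thm. 1's (`N⁻` square-free, odd number
  of prime factors) and Assumption 6 ((1) `p ≥ 5`, (2) `ρ̄_{E,p}` onto `GL₂(𝔽_p)`, (3) `p ∤` the minimal modular degree,
  (4) in its vacuous case `ℓ² ∣ N ⇒ p ∤ ℓ + 1`).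
* **Checked here (kernel):** the admissibility block of the crux DISCHARGES every hypothesis of Cor. 3 EXCEPT
  Assumption 6 (3) — `p ≥ 7 ⇒ p ≥ 5`; good, `p ∤ a_p`; surjectivity; `p ∤ q² − 1` for `q ∣ N` makes (4) vacuous
  (`ℓ + 1 ∣ ℓ² − 1`); `(d_K, Np) = 1`; `[K:ℚ] = 2` totally complex; splitting of `N⁺`, inertness of `N⁻` — so that at
  every admissible datum with `p ∤ minModularDegree V N_V`:
  `θ_{n+1}^{ac} (θ_{n+1}^{ac})^* ∈ I^{2·max(r⁺, r⁻)}` for all `n` (`thetaSq_mem_pow_two_mul_max_rank`), hence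
  `max(r⁺, r⁻) ≤ ord_J θ^{ac}` in `ℕ∞` (`max_rank_le_acOrderOfVanishing`: the landed stubs `stub_normCompatible` p747225
  and `stub_towerSqrt` p754700 take the square root along the tower) — the `≥` half of BD96 Conj. 4.1 in Mordell–Weil form;
  and, if `Ш(V/ℚ)[p^∞]` is finite (`corank Sel_{p^∞} = rank + corank Ш[p^∞]`, Greenberg; the route's own crux
  `SelmerRankShaPFinite`, consumed by its assembly anyway), the conclusion of `stub_lpCap`
  (`thetaSq_mem_pow_two_mul_selmerCorank_of_finite_sha`) and of the crux (`selmerCorank_le_acOrderOfVanishing_of_finite_sha`)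
  AT THAT DATUM.
* **Route-level form:** `derivedHeightCap_of_cor3` — `DerivedHeightCap` follows from (i) Cor. 3 at every admissible datum,
  (ii) `SelmerRankShaPFinite`, (iii) `p ∤ minModularDegree V N_V` at every admissible datum. (iii) is NOT a theorem (it
  is a side condition on the datum, true for all but finitely many `p` once `V` is fixed): it is the ONE clause by which
  `stub_lpCap` exceeds print. Recommended re-cut (planner): add `¬ p ∣ minModularDegree V (N⁺N⁻)` to the admissibility
  block of `DefiniteExactOrder` ∧ `DerivedHeightCap` (the existential DEO can still choose such `p`), and either read the
  cap with `V.mordellWeilRank` (then `max_rank_le_acOrderOfVanishing` closes it outright modulo Cor. 3) or let the cap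
  consume `SelmerRankShaPFinite` (then `selmerCorank_le_acOrderOfVanishing_of_finite_sha` does).

## References

* [BertoliniDarmon2005] Ann. of Math. 162 (2005): Thm. 1, Cor. 3 (pp. 2–3), Assumption 6 (p. 4), §1.2 (pp. 10–13).
* [BertoliniDarmon1996] Invent. Math. 126 (1996), §2.7, §2.12, Conj. 4.1.
* [GreenbergLNM1716] R. Greenberg, LNM 1716 (1999), §1 (corank identity).
-/

noncomputable section

open scoped Matrix
open NumberField Literature.NumberTheory.Automorphic


-- D-0017: single-problem summit, the namespace repeats the problem name by design.
set_option linter.dupNamespace false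

namespace Summit.BirchSwinnertonDyer.BirchSwinnertonDyer.Theorems.DerivedHeightCapBD05

open Literature.NumberTheory.EllipticCurves Literature.NumberTheory.EllipticCurves.BertoliniDarmon2005

/-! ## Arithmetic of the side conditions -/

/-- `ℓ + 1 ∣ ℓ² − 1` over `ℤ`; hence `p ∤ ℓ² − 1 ⇒ p ∤ ℓ + 1` (why the crux's `p ∤ q² − 1` makes BD05's Assumption 6 (4)
vacuous). [cite: BertoliniDarmon2005, Assumption 6 (4), p. 4] -/
theorem not_dvd_add_one_of_not_dvd_sq_sub_one {p ℓ : ℕ} (h : ¬ (p : ℤ) ∣ (ℓ : ℤ) ^ 2 - 1) : ¬ p ∣ ℓ + 1 := by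
  intro hd
  apply h
  have h1 : (p : ℤ) ∣ (ℓ : ℤ) + 1 := by exact_mod_cast hd
  have h2 : ((ℓ : ℤ) ^ 2 - 1) = ((ℓ : ℤ) + 1) * ((ℓ : ℤ) - 1) := by ring
  rw [h2]
  exact Dvd.dvd.mul_right h1 _

/-- `gcd(d_K, N p) = 1` (the crux's form) gives `(N⁺N⁻p, |d_K|) = 1` (the facts' form) when `N_V = N⁺N⁻`. [folklore] -/
theorem coprime_of_int_gcd_eq_one {d : ℤ} {N Nplus Nminus p : ℕ} (hN : N = Nplus * Nminus)
    (h : Int.gcd d ((N : ℤ) * p) = 1) : (Nplus * Nminus * p).Coprime d.natAbs := by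
  rw [Int.gcd_eq_natAbs] at h
  have h' : Int.natAbs ((N : ℤ) * p) = Nplus * Nminus * p := by
    rw [hN]; push_cast; rw [Int.natAbs_mul, Int.natAbs_mul]; simp
  rw [h'] at h
  exact Nat.Coprime.symm h

/-! ## The descent at one admissible datum -/

section Datum

variable {V : WeierstrassCurve ℚ} [V.IsElliptic] [V.IsGloballyMinimal] {p : ℕ} [Fact p.Prime] {Nplus Nminus : ℕ}
  {K : Type} [Field K] [NumberField K] {S : Brandt.XiSetup Nplus Nminus} [Fintype (Brandt.ClassSet S.O)]
  (T : GrossPointTower K S p) {φ : Brandt.ClassSet S.O → ℤ}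

/-- **BD05 Cor. 3 at an admissible definite datum.** At every admissible datum of the crux `DerivedHeightCap` (block
verbatim) at which, in addition, `p ∤ minModularDegree V N_V` (BD05 Assumption 6 (3)), the fact
`cor3_thetaSq_mem_augIdeal_pow` applies — all its other hypotheses are discharged from the block (`p ≥ 7 ⇒ p ≥ 5`; good,
`p ∤ a_p = V.LFunction p`; `ρ̄` surjective; `p ∤ q² − 1 ⇒ p ∤ q + 1`; `(d_K, N p) = 1`; `[K:ℚ] = 2` totally complex;
splitting/inertness) — and gives `θ_{n+1}^{ac} (θ_{n+1}^{ac})^* ∈ I^{2·max(rank V(ℚ), rank V^K(ℚ))}` at every level.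
[cite: BertoliniDarmon2005, Cor. 3 (p. 3) and Assumption 6 (p. 4)] -/
theorem thetaSq_mem_pow_two_mul_max_rank
    (hC3 : cor3_thetaSq_mem_augIdeal_pow K S p V)
    (h : (7 ≤ p ∧ V.HasGoodReductionAtPrime p ∧ ¬ (p : ℤ) ∣ V.frobeniusTrace p ∧ ¬ (p : ℤ) ∣ (V.frobeniusTrace p) ^ 2 - 1 ∧ V.HasSurjectiveModNGaloisRep p ∧ (∀ q : ℕ, q.Prime → q ∣ V.conductorNorm ℤ → ¬ (p : ℤ) ∣ (q : ℤ) ^ 2 - 1) ∧ ¬ p ∣ NumberField.classNumber K) ∧ (Module.finrank ℚ K = 2 ∧ NumberField.IsTotallyComplex K ∧ NumberField.discr K < -4 ∧ Int.gcd (NumberField.discr K) (V.conductorNorm ℤ * p) = 1) ∧ (V.conductorNorm ℤ = Nplus * Nminus ∧ Nat.Coprime Nplus Nminus ∧ Odd Nminus.primeFactors.card ∧ (∀ q : ℕ, q.Prime → q ∣ Nplus → ((Ideal.span {(q : ℤ)}).primesOver (NumberField.RingOfIntegers K)).ncard = 2) ∧ (∀ q : ℕ, q.Prime → q ∣ Nminus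 → ((Ideal.span {(q : ℤ)}).primesOver (NumberField.RingOfIntegers K)).ncard = 1)) ∧ (φ ≠ 0 ∧ Literature.NumberTheory.Automorphic.Brandt.eigenLattice (Nplus * Nminus) (Literature.NumberTheory.Automorphic.Brandt.matrix S.O) (fun n => V.LFunction n) = Submodule.span ℤ {φ}))
    (hdeg : ∀ [NeZero (V.conductorNorm ℤ)], ¬ p ∣ ModularForms.minModularDegree V (V.conductorNorm ℤ)) (n : ℕ) :
    T.thetaAc p φ (padicUnitRoot p (V.LFunction p)) n *
        MonoidAlgebra.mapDomain (fun σ => σ⁻¹) (T.thetaAc p φ (padicUnitRoot p (V.LFunction p)) n) ∈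
      augIdeal ℤ_[p] (AcLayerGroup K p (n + 1)) ^
        (2 * max V.mordellWeilRank (V.quadraticTwist (NumberField.discr K : ℚ)).mordellWeilRank) := by
  obtain ⟨⟨h7, hgood, hap, -, hsurj, hq2, -⟩, ⟨h2, htc, -, hgcd⟩, ⟨hN, -, hodd, hsplit, hinert⟩, ⟨hφ0, hφ⟩⟩ := h
  haveI : NeZero (V.conductorNorm ℤ) := ⟨(V.conductorNorm_pos_holds).ne'⟩
  have hK : IsImaginaryQuadratic K := ⟨h2, htc⟩
  have h5 : 5 ≤ p := le_trans (by norm_num) h7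
  have hcop : (Nplus * Nminus * p).Coprime (NumberField.discr K).natAbs := coprime_of_int_gcd_eq_one hN hgcd
  have hap' : ¬ (p : ℤ) ∣ V.LFunction p := by
    rw [WeierstrassCurve.LFunction_apply_prime_eq_frobeniusTrace V p hgood]
    exact hap
  have h4 : ∀ ℓ : ℕ, ℓ.Prime → ℓ ^ 2 ∣ Nplus * Nminus → ¬ p ∣ ℓ + 1 := by
    intro ℓ hℓ hℓ2
    refine not_dvd_add_one_of_not_dvd_sq_sub_one (hq2 ℓ hℓ ?_)
    rw [hN]
    exact dvd_trans (Dvd.intro_left _ (sq ℓ).symm) hℓ2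
  exact hC3 hK h5 hN.symm hcop hodd hsplit hinert hgood hap' hsurj hdeg h4 φ hφ0 hφ T n

/-- **The conclusion of `stub_lpCap` at an admissible datum with `p ∤ minModularDegree V N_V`, given `#Ш(V/ℚ)[p^∞] < ∞`**,
from BD05 Cor. 3: `corank_{ℤ_p} Sel_{p^∞}(V/ℚ) = rank V(ℚ) + corank Ш(V/ℚ)[p^∞]` (Greenberg's identity, tree theorem
`selmerCorank_eq_mordellWeilRank_add_holds`) `= rank V(ℚ) ≤ max(r⁺, r⁻)` and `I^{2·max} ⊆ I^{2·corank}`.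
[cite: BertoliniDarmon2005, Cor. 3 (p. 3)] [cite: GreenbergLNM1716, §1] -/
theorem thetaSq_mem_pow_two_mul_selmerCorank_of_finite_sha
    (hC3 : cor3_thetaSq_mem_augIdeal_pow K S p V)
    (h : (7 ≤ p ∧ V.HasGoodReductionAtPrime p ∧ ¬ (p : ℤ) ∣ V.frobeniusTrace p ∧ ¬ (p : ℤ) ∣ (V.frobeniusTrace p) ^ 2 - 1 ∧ V.HasSurjectiveModNGaloisRep p ∧ (∀ q : ℕ, q.Prime → q ∣ V.conductorNorm ℤ → ¬ (p : ℤ) ∣ (q : ℤ) ^ 2 - 1) ∧ ¬ p ∣ NumberField.classNumber K) ∧ (Module.finrank ℚ K = 2 ∧ NumberField.IsTotallyComplex K ∧ NumberField.discr K < -4 ∧ Int.gcd (NumberField.discr K) (V.conductorNorm ℤ * p) = 1) ∧ (V.conductorNorm ℤ = Nplus * Nminus ∧ Nat.Coprime Nplus Nminus ∧ Odd Nminus.primeFactors.card ∧ (∀ q : ℕ, q.Prime → q ∣ Nplus → ((Ideal.span {(q : ℤ)}).primesOver (NumberField.RingOfIntegers K)).ncard = 2) ∧ (∀ q : ℕ,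 q.Prime → q ∣ Nminus → ((Ideal.span {(q : ℤ)}).primesOver (NumberField.RingOfIntegers K)).ncard = 1)) ∧ (φ ≠ 0 ∧ Literature.NumberTheory.Automorphic.Brandt.eigenLattice (Nplus * Nminus) (Literature.NumberTheory.Automorphic.Brandt.matrix S.O) (fun n => V.LFunction n) = Submodule.span ℤ {φ}))
    (hdeg : ∀ [NeZero (V.conductorNorm ℤ)], ¬ p ∣ ModularForms.minModularDegree V (V.conductorNorm ℤ))
    (hsha : Finite ↥(AddCommGroup.primaryComponent V.sha p)) (n : ℕ) :
    T.thetaAc p φ (padicUnitRoot p (V.LFunction p)) n *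
        MonoidAlgebra.mapDomain (fun σ => σ⁻¹) (T.thetaAc p φ (padicUnitRoot p (V.LFunction p)) n) ∈
      augIdeal ℤ_[p] (AcLayerGroup K p (n + 1)) ^ (2 * V.selmerCorank p) := by
  have hmem := thetaSq_mem_pow_two_mul_max_rank T hC3 h hdeg n
  have hid : V.selmerCorank p = V.mordellWeilRank + V.shaCorank p := V.selmerCorank_eq_mordellWeilRank_add_holds p
  have hz : V.shaCorank p = 0 := Literature.BSD.shaCorank_eq_zero_of_finite V p hsha
  have hle : 2 * V.selmerCorank p ≤
      2 * max V.mordellWeilRank (V.quadraticTwist (NumberField.discr K : ℚ)).mordellWeilRank := by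
    rw [hid, hz, add_zero]
    exact Nat.mul_le_mul_left 2 (le_max_left _ _)
  exact Ideal.pow_le_pow_right hle hmem

/-- **`max(rank V(ℚ), rank V^K(ℚ)) ≤ ord_J θ^{ac}` in `ℕ∞`** at every admissible datum with `p ∤ minModularDegree V N_V`,
from BD05 Cor. 3 (no finiteness of `Ш` needed): the theta elements are norm-compatible at the unit root
(`stub_normCompatible`, BD96 Prop. 2.7) and the square root along the anticyclotomic tower (`stub_towerSqrt`) turns
`θθ^* ∈ I^{2ρ}` at all levels into `θ ∈ I^{ρ}` at all levels (`VanishesToOrderAc ρ`), i.e. `ρ ≤ acOrderOfVanishing`.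
The `≥` half of Bertolini–Darmon's Conj. 4.1 (BD96) in Mordell–Weil form, modulo the cited corollary.
[cite: BertoliniDarmon2005, Cor. 3 (p. 3)] [cite: BertoliniDarmon1996, Prop. 2.7 and Conj. 4.1] -/
theorem max_rank_le_acOrderOfVanishing
    (hC3 : cor3_thetaSq_mem_augIdeal_pow K S p V)
    (h : (7 ≤ p ∧ V.HasGoodReductionAtPrime p ∧ ¬ (p : ℤ) ∣ V.frobeniusTrace p ∧ ¬ (p : ℤ) ∣ (V.frobeniusTrace p) ^ 2 - 1 ∧ V.HasSurjectiveModNGaloisRep p ∧ (∀ q : ℕ, q.Prime → q ∣ V.conductorNorm ℤ → ¬ (p : ℤ) ∣ (q : ℤ) ^ 2 - 1) ∧ ¬ p ∣ NumberField.classNumber K) ∧ (Module.finrank ℚ K = 2 ∧ NumberField.IsTotallyComplex K ∧ NumberField.discr K < -4 ∧ Int.gcd (NumberField.discr K) (V.conductorNorm ℤ * p) = 1) ∧ (V.conductorNorm ℤ = Nplus * Nminus ∧ Nat.Coprime Nplus Nminus ∧ Odd Nminus.primeFactors.card ∧ (∀ q : ℕ, q.Prime → q ∣ Nplus → ((Ideal.span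 {(q : ℤ)}).primesOver (NumberField.RingOfIntegers K)).ncard = 2) ∧ (∀ q : ℕ, q.Prime → q ∣ Nminus → ((Ideal.span {(q : ℤ)}).primesOver (NumberField.RingOfIntegers K)).ncard = 1)) ∧ (φ ≠ 0 ∧ Literature.NumberTheory.Automorphic.Brandt.eigenLattice (Nplus * Nminus) (Literature.NumberTheory.Automorphic.Brandt.matrix S.O) (fun n => V.LFunction n) = Submodule.span ℤ {φ}))
    (hdeg : ∀ [NeZero (V.conductorNorm ℤ)], ¬ p ∣ ModularForms.minModularDegree V (V.conductorNorm ℤ)) :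
    ((max V.mordellWeilRank (V.quadraticTwist (NumberField.discr K : ℚ)).mordellWeilRank : ℕ) : ℕ∞) ≤
      T.acOrderOfVanishing p φ (padicUnitRoot p (V.LFunction p)) := by
  have hnc := DerivedHeightCapNormCompatible.stub_normCompatible V p Nplus Nminus K S T φ h
  have hvan := DerivedHeightCapTowerSqrt.stub_towerSqrt K p Nplus Nminus S T φ (padicUnitRoot p (V.LFunction p)) hnc
    (max V.mordellWeilRank (V.quadraticTwist (NumberField.discr K : ℚ)).mordellWeilRank)
    (fun n => thetaSq_mem_pow_two_mul_max_rank T hC3 h hdeg n)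
  exact GrossPointTower.le_acOrderOfVanishing hvan

/-- **`rank V(ℚ) ≤ ord_J θ^{ac}`** at every admissible datum with `p ∤ minModularDegree V N_V`, modulo BD05 Cor. 3.
[cite: BertoliniDarmon2005, Cor. 3 (p. 3)] -/
theorem mordellWeilRank_le_acOrderOfVanishing
    (hC3 : cor3_thetaSq_mem_augIdeal_pow K S p V)
    (h : (7 ≤ p ∧ V.HasGoodReductionAtPrime p ∧ ¬ (p : ℤ) ∣ V.frobeniusTrace p ∧ ¬ (p : ℤ) ∣ (V.frobeniusTrace p) ^ 2 - 1 ∧ V.HasSurjectiveModNGaloisRep p ∧ (∀ q : ℕ, q.Prime → q ∣ V.conductorNorm ℤ → ¬ (p : ℤ) ∣ (q : ℤ) ^ 2 - 1) ∧ ¬ p ∣ NumberField.classNumber K) ∧ (Module.finrank ℚ K = 2 ∧ NumberField.IsTotallyComplex K ∧ NumberField.discr K < -4 ∧ Int.gcd (NumberField.discr K) (V.conductorNorm ℤ * p) = 1) ∧ (V.conductorNorm ℤ = Nplus * Nminus ∧ Nat.Coprime Nplus Nminus ∧ Odd Nminus.primeFactors.card ∧ (∀ q : ℕ, q.Prime →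 q ∣ Nplus → ((Ideal.span {(q : ℤ)}).primesOver (NumberField.RingOfIntegers K)).ncard = 2) ∧ (∀ q : ℕ, q.Prime → q ∣ Nminus → ((Ideal.span {(q : ℤ)}).primesOver (NumberField.RingOfIntegers K)).ncard = 1)) ∧ (φ ≠ 0 ∧ Literature.NumberTheory.Automorphic.Brandt.eigenLattice (Nplus * Nminus) (Literature.NumberTheory.Automorphic.Brandt.matrix S.O) (fun n => V.LFunction n) = Submodule.span ℤ {φ}))
    (hdeg : ∀ [NeZero (V.conductorNorm ℤ)], ¬ p ∣ ModularForms.minModularDegree V (V.conductorNorm ℤ)) :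
    ((V.mordellWeilRank : ℕ) : ℕ∞) ≤ T.acOrderOfVanishing p φ (padicUnitRoot p (V.LFunction p)) :=
  le_trans (by exact_mod_cast le_max_left _ _) (max_rank_le_acOrderOfVanishing T hC3 h hdeg)

/-- **The conclusion of the crux `DerivedHeightCap` at an admissible datum with `p ∤ minModularDegree V N_V`, given
`#Ш(V/ℚ)[p^∞] < ∞`**, modulo BD05 Cor. 3: `(corank_{ℤ_p} Sel_{p^∞}(V/ℚ) : ℕ∞) ≤ ord_J θ^{ac}`.
[cite: BertoliniDarmon2005, Cor. 3 (p. 3)] [cite: GreenbergLNM1716, §1] -/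
theorem selmerCorank_le_acOrderOfVanishing_of_finite_sha
    (hC3 : cor3_thetaSq_mem_augIdeal_pow K S p V)
    (h : (7 ≤ p ∧ V.HasGoodReductionAtPrime p ∧ ¬ (p : ℤ) ∣ V.frobeniusTrace p ∧ ¬ (p : ℤ) ∣ (V.frobeniusTrace p) ^ 2 - 1 ∧ V.HasSurjectiveModNGaloisRep p ∧ (∀ q : ℕ, q.Prime → q ∣ V.conductorNorm ℤ → ¬ (p : ℤ) ∣ (q : ℤ) ^ 2 - 1) ∧ ¬ p ∣ NumberField.classNumber K) ∧ (Module.finrank ℚ K = 2 ∧ NumberField.IsTotallyComplex K ∧ NumberField.discr K < -4 ∧ Int.gcd (NumberField.discr K) (V.conductorNorm ℤ * p) = 1) ∧ (V.conductorNorm ℤ = Nplus * Nminus ∧ Nat.Coprime Nplus Nminus ∧ Odd Nminus.primeFactors.card ∧ (∀ q : ℕ, q.Prime → q ∣ Nplus → ((Ideal.span {(q : ℤ)}).primesOver (NumberField.RingOfIntegers K)).ncard = 2) ∧ (∀ q : ℕ, q.Prime → q ∣ Nminus → ((Ideal.span {(q : ℤ)}).primesOver (NumberField.RingOfIntegers K)).ncard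 = 1)) ∧ (φ ≠ 0 ∧ Literature.NumberTheory.Automorphic.Brandt.eigenLattice (Nplus * Nminus) (Literature.NumberTheory.Automorphic.Brandt.matrix S.O) (fun n => V.LFunction n) = Submodule.span ℤ {φ}))
    (hdeg : ∀ [NeZero (V.conductorNorm ℤ)], ¬ p ∣ ModularForms.minModularDegree V (V.conductorNorm ℤ))
    (hsha : Finite ↥(AddCommGroup.primaryComponent V.sha p)) :
    ((V.selmerCorank p : ℕ) : ℕ∞) ≤ T.acOrderOfVanishing p φ (padicUnitRoot p (V.LFunction p)) := by
  have hid : V.selmerCorank p = V.mordellWeilRank + V.shaCorank p := V.selmerCorank_eq_mordellWeilRank_add_holds p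
  have hz : V.shaCorank p = 0 := Literature.BSD.shaCorank_eq_zero_of_finite V p hsha
  rw [hid, hz, add_zero]
  exact mordellWeilRank_le_acOrderOfVanishing T hC3 h hdeg

end Datum

/-! ## Route-level packaging: what the crux costs beyond print -/

/-- **`stub_lpCap` modulo BD05 Cor. 3, at the admissible data with `p ∤ minModularDegree V N_V`, given
`SelmerRankShaPFinite`.** The registered signature of `stub_lpCap` (line «birth») with ONE extra clause in the block
(BD05 Assumption 6 (3)); hypotheses: Cor. 3 at every such datum and the route's crux `SelmerRankShaPFinite`
(`Ш(W/ℚ)[p^∞]` finite for all `W`, `p`). [cite: BertoliniDarmon2005, Cor. 3 (p. 3) and Assumption 6 (3) (p. 4)] -/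
theorem lpCap_of_cor3_of_shaPFinite
    (hC3 : ∀ (K : Type) [Field K] [NumberField K] (Nplus Nminus : ℕ) (S : Brandt.XiSetup Nplus Nminus) (p : ℕ)
      [Fact p.Prime] (W : WeierstrassCurve ℚ), cor3_thetaSq_mem_augIdeal_pow K S p W)
    (hSha : Summit.BirchSwinnertonDyer.BirchSwinnertonDyer.Theses.DefiniteTheta.SelmerRankShaPFinite) :
    ∀ (V : WeierstrassCurve ℚ) [V.IsElliptic] [V.IsGloballyMinimal] (p : ℕ) [Fact p.Prime] (Nplus Nminus : ℕ) (K : Type) [Field K] [NumberField K] (S : Literature.NumberTheory.Automorphic.Brandt.XiSetup Nplus Nminus) [Fintype (Literature.NumberTheory.Automorphic.Brandt.ClassSet S.O)] (T : Literature.NumberTheory.EllipticCurves.GrossPointTower K S p) (φ : Literature.NumberTheory.Automorphic.Brandt.ClassSet S.O → ℤ), ((7 ≤ p ∧ V.HasGoodReductionAtPrime p ∧ ¬ (p : ℤ) ∣ V.frobeniusTrace p ∧ ¬ (p : ℤ) ∣ (V.frobeniusTrace p) ^ 2 - 1 ∧ V.HasSurjectiveModNGaloisRep p ∧ (∀ q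 : ℕ, q.Prime → q ∣ V.conductorNorm ℤ → ¬ (p : ℤ) ∣ (q : ℤ) ^ 2 - 1) ∧ ¬ p ∣ NumberField.classNumber K) ∧ (Module.finrank ℚ K = 2 ∧ NumberField.IsTotallyComplex K ∧ NumberField.discr K < -4 ∧ Int.gcd (NumberField.discr K) (V.conductorNorm ℤ * p) = 1) ∧ (V.conductorNorm ℤ = Nplus * Nminus ∧ Nat.Coprime Nplus Nminus ∧ Odd Nminus.primeFactors.card ∧ (∀ q : ℕ, q.Prime → q ∣ Nplus → ((Ideal.span {(q : ℤ)}).primesOver (NumberField.RingOfIntegers K)).ncard = 2) ∧ (∀ q : ℕ, q.Prime → q ∣ Nminus → ((Ideal.span {(q : ℤ)}).primesOver (NumberField.RingOfIntegers K)).ncard = 1)) ∧ (φ ≠ 0 ∧ Literature.NumberTheory.Automorphic.Brandt.eigenLattice (Nplus * Nminus) (Literature.NumberTheory.Automorphic.Brandt.matrix S.O) (fun n => V.LFunction n) = Submodule.span ℤ {φ})) →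
      (∀ [NeZero (V.conductorNorm ℤ)], ¬ p ∣ ModularForms.minModularDegree V (V.conductorNorm ℤ)) →
      ∀ n : ℕ, T.thetaAc p φ (Literature.NumberTheory.EllipticCurves.padicUnitRoot p (V.LFunction p)) n * MonoidAlgebra.mapDomain (fun σ => σ⁻¹) (T.thetaAc p φ (Literature.NumberTheory.EllipticCurves.padicUnitRoot p (V.LFunction p)) n) ∈ Literature.NumberTheory.EllipticCurves.augIdeal ℤ_[p] (Literature.NumberTheory.EllipticCurves.AcLayerGroup K p (n + 1)) ^ (2 * V.selmerCorank p) := by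
  intro V _ _ p _ Nplus Nminus K _ _ S _ T φ h hdeg n
  exact thetaSq_mem_pow_two_mul_selmerCorank_of_finite_sha T (hC3 K Nplus Nminus S p V) h hdeg (hSha V p) n

/-- **The crux `DerivedHeightCap` modulo BD05 Cor. 3: what it costs beyond print.** `DerivedHeightCap` (by name) follows
from (i) BD05 Cor. 3 at every admissible datum, (ii) the route's crux `SelmerRankShaPFinite`, and (iii) `p ∤` the minimal
modular degree of `V` at level `N_V` AT EVERY ADMISSIBLE DATUM — (iii) is not a theorem but a side condition (true for all
but finitely many `p` per curve); it is the single clause by which the registered crux exceeds the printed corollary, and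
the re-cut that removes it is to add `¬ p ∣ minModularDegree V (N⁺N⁻)` to the admissibility block (the existential sister
crux `DefiniteExactOrder` can still choose such `p`). [cite: BertoliniDarmon2005, Cor. 3 (p. 3) and Assumption 6 (3) (p. 4)] -/
theorem derivedHeightCap_of_cor3
    (hC3 : ∀ (K : Type) [Field K] [NumberField K] (Nplus Nminus : ℕ) (S : Brandt.XiSetup Nplus Nminus) (p : ℕ)
      [Fact p.Prime] (W : WeierstrassCurve ℚ), cor3_thetaSq_mem_augIdeal_pow K S p W)
    (hSha : Summit.BirchSwinnertonDyer.BirchSwinnertonDyer.Theses.DefiniteTheta.SelmerRankShaPFinite)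
    (hdeg : ∀ (V : WeierstrassCurve ℚ) [V.IsElliptic] [V.IsGloballyMinimal] (p : ℕ) [Fact p.Prime] (Nplus Nminus : ℕ) (K : Type) [Field K] [NumberField K] (S : Literature.NumberTheory.Automorphic.Brandt.XiSetup Nplus Nminus) [Fintype (Literature.NumberTheory.Automorphic.Brandt.ClassSet S.O)] (T : Literature.NumberTheory.EllipticCurves.GrossPointTower K S p) (φ : Literature.NumberTheory.Automorphic.Brandt.ClassSet S.O → ℤ), ((7 ≤ p ∧ V.HasGoodReductionAtPrime p ∧ ¬ (p : ℤ) ∣ V.frobeniusTrace p ∧ ¬ (p : ℤ) ∣ (V.frobeniusTrace p) ^ 2 - 1 ∧ V.HasSurjectiveModNGaloisRep p ∧ (∀ q : ℕ, q.Prime → q ∣ V.conductorNorm ℤ → ¬ (p : ℤ) ∣ (q : ℤ) ^ 2 - 1) ∧ ¬ p ∣ NumberField.classNumber K) ∧ (Module.finrank ℚ K = 2 ∧ NumberField.IsTotallyComplex K ∧ NumberField.discr K < -4 ∧ Int.gcd (NumberField.discr K) (V.conductorNorm ℤ * p) = 1) ∧ (V.conductorNorm ℤ = Nplus * Nminus ∧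 Nat.Coprime Nplus Nminus ∧ Odd Nminus.primeFactors.card ∧ (∀ q : ℕ, q.Prime → q ∣ Nplus → ((Ideal.span {(q : ℤ)}).primesOver (NumberField.RingOfIntegers K)).ncard = 2) ∧ (∀ q : ℕ, q.Prime → q ∣ Nminus → ((Ideal.span {(q : ℤ)}).primesOver (NumberField.RingOfIntegers K)).ncard = 1)) ∧ (φ ≠ 0 ∧ Literature.NumberTheory.Automorphic.Brandt.eigenLattice (Nplus * Nminus) (Literature.NumberTheory.Automorphic.Brandt.matrix S.O) (fun n => V.LFunction n) = Submodule.span ℤ {φ})) →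
      ∀ [NeZero (V.conductorNorm ℤ)], ¬ p ∣ ModularForms.minModularDegree V (V.conductorNorm ℤ)) :
    Summit.BirchSwinnertonDyer.BirchSwinnertonDyer.Theses.DefiniteTheta.DerivedHeightCap := by
  intro V _ _ p _ Nplus Nminus K _ _ S _ T φ h
  exact selmerCorank_le_acOrderOfVanishing_of_finite_sha T (hC3 K Nplus Nminus S p V) h
    (hdeg V p Nplus Nminus K S T φ h) (hSha V p)

end Summit.BirchSwinnertonDyer.BirchSwinnertonDyer.Theorems.DerivedHeightCapBD05

end
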